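import Literature.MathematicalPhysics.QuantumManyBody.PeriodicMaxFormBoundBounded
import Literature.Analysis.FunctionSpaces.TorusLipschitzFourierH1
import HarnessLib

/-!
# The maximal-form bound for integrable interactions: the `C¹` Bose core realises the infimum

Topic `Literature/MathematicalPhysics/QuantumManyBody`, sequel of `PeriodicMaxFormBoundBounded.lean`.
**Main result** (`periodicGroundStateEnergy_le_maxForm`, Simon's form-core theorem for the periodic
`N`-body Hamiltonian with an INTEGRABLE pair interaction, in the Bose sector): for `L > 0`, a
measurable profile `w` with `∫_{[0,L)^{3N}} W < ∞`, `W = ∑_{i<j} w^per(xᵢ - xⱼ)`, and every unit vector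
`η ∈ L²((ℝ/ℤ)^{3N})` (Haar probability measure) that is Bose-symmetric in momentum space,

  `periodicGroundStateEnergy w N L ≤ ∑ₙ (∑ₚ (2πnₚ/L)²) |⟪eₙ, η⟫|² + ∫ (W ∘ fromUnitTorusN L) |η|²`,

i.e. the infimum of the energy over the `C¹` periodic Bose-symmetric core equals the infimum of the
MAXIMAL form `H¹ ∩ {∫ W|u|² < ∞}` (B. Simon, *J. Operator Theory* 1 (1979) 37–47; Kato). This is the
hypothesis `hcore` ("MaxFormBound") of the truncation argument `E₀(min(v,n)) ↑ E₀(v)` at fixed volume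
(`Summits/AtomisticToContinuum/BoseEinsteinCondensation/Theorems/…TruncationCompactness.lean`) in the
integrable case; hard cores (`∫ W = ∞`) are NOT covered.

Proof: truncate `η` with the `1`-Lipschitz clamp `clampC k` (`TorusLipschitzFourierH1`): the
truncations `fₖ = clampC k ∘ η` are bounded, Bose-symmetric (Bose symmetry in momentum space is
a.e. invariance under the particle permutations of the torus coordinates,
`ae_eq_comp_perm_of_inner_symm`, which composition with `clampC k` preserves), their spectral kinetic
energy is at most that of `η` (`Torus.tsum_weight_mul_enorm_mFourierCoeff_clampC_le`: Lipschitz maps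
contract the Fourier-side `H¹` seminorms) and `∫ W|fₖ|² ≤ ∫ W|η|²` pointwise; the bounded case
(`periodicGroundStateEnergy_mul_le_maxForm_of_bound`) gives `E₀ ‖fₖ‖² ≤ Q(η)`, and `‖fₖ‖ → ‖η‖ = 1`
by dominated convergence.

## References

* B. Simon, *Maximal and minimal Schrödinger forms*, J. Operator Theory 1 (1979) 37–47, Thm. 2.1.
* T. Kato, *Perturbation Theory for Linear Operators*, VI §1.3–1.4; [ReedSimonIV1978] Thm. XIII.64.
-/

noncomputable section

open MeasureTheory Filter Set Complex UnitAddTorus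
open scoped ENNReal NNReal Topology InnerProductSpace
open Literature.Analysis.FunctionSpaces Literature.Analysis.OperatorTheory

namespace Literature.MathematicalPhysics.QuantumManyBody.BoseGas

/-! ### Bridge between the Haar-probability convention and the global `volume` of `FlatTorus` -/

section Bridge

/-- `L²` for the Haar product measure on `(ℝ/ℤ)^D` is `L²` for the global `volume` (the two measures
coincide, `Torus.volume_eq_pi_haarAddCircle`). [folklore] -/
theorem memLp_piHaar_iff {D : Type*} [Fintype D] {g : UnitAddTorus D → ℂ} {p : ℝ≥0∞} :
    MemLp g p (Measure.pi fun _ : D => (AddCircle.haarAddCircle : Measure UnitAddCircle)) ↔ MemLp g p volume := by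
  rw [Torus.volume_eq_pi_haarAddCircle]

end Bridge

-- The measure on `ℝ/ℤ` is the Haar PROBABILITY measure, as in `PeriodicFormDomain.lean`.
attribute [local instance] formDomain_measureSpace formDomain_isProbabilityMeasure formDomain_isProbabilityMeasure_pi

variable {N : ℕ} {L : ℝ}

/-- Local notation for the Hilbert space `L²((ℝ/ℤ)^{3N})`, as in `PeriodicFormDomain.lean`. -/
local notation "L2T " N':max => Lp ℂ 2 (volume : Measure (UnitAddTorus (Fin N' × Fin 3)))

/-! ### Bose symmetry in momentum space is a.e. invariance under particle permutations -/

section Symmetry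

variable {D : Type*} [Fintype D]

/-- The coordinate permutation `t ↦ t ∘ τ` of `(ℝ/ℤ)^D` preserves the Haar product measure. [folklore] -/
theorem measurePreserving_compPerm (τ : Equiv.Perm D) :
    MeasurePreserving (MeasurableEquiv.arrowCongr' τ.symm (MeasurableEquiv.refl UnitAddCircle))
      (volume : Measure (UnitAddTorus D)) volume := by
  rw [volume_pi]
  exact measurePreserving_arrowCongr' _ _ _ _ fun _ => MeasurePreserving.id _

omit [Fintype D] in
/-- Pointwise form of the coordinate permutation. [folklore] -/
theorem compPerm_apply (τ : Equiv.Perm D) (t : UnitAddTorus D) :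
    (MeasurableEquiv.arrowCongr' τ.symm (MeasurableEquiv.refl UnitAddCircle) t : UnitAddTorus D) = fun i => t (τ i) :=
  funext fun _ => rfl

/-- **Fourier coefficients of a coordinate-permuted function**: `𝓕(g ∘ (· ∘ τ))(n) = 𝓕g(n ∘ τ)` for
every function `g` (change of variables in the Haar product measure). [folklore] -/
theorem mFourierCoeff_comp_compPerm (g : UnitAddTorus D → ℂ) (τ : Equiv.Perm D) (n : D → ℤ) :
    mFourierCoeff (fun t : UnitAddTorus D => g (fun i => t (τ i))) n = mFourierCoeff g (fun i => n (τ i)) := by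
  unfold mFourierCoeff
  have h := (measurePreserving_compPerm (D := D) τ).integral_comp'
    (g := fun s : UnitAddTorus D => mFourier (-fun i => n (τ i)) s • g s)
  rw [← h]
  refine integral_congr_ae (Eventually.of_forall fun t => ?_)
  dsimp only
  rw [compPerm_apply]
  congr 1
  rw [HaarTorus.mFourier_comp_perm]
  have hneg : (fun i => (-fun i => n (τ i)) (τ.symm i)) = -n := by
    funext i
    simp
  rw [hneg]

/-- Two `L²` classes with the same Fourier coefficients are equal. [folklore] -/
theorem Lp_eq_of_forall_inner_mFourierLp_eq {x y : Lp ℂ 2 (volume : Measure (UnitAddTorus D))}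
    (h : ∀ n : D → ℤ, ⟪(mFourierLp 2 n : Lp ℂ 2 (volume : Measure (UnitAddTorus D))), x⟫_ℂ =
      ⟪(mFourierLp 2 n : Lp ℂ 2 (volume : Measure (UnitAddTorus D))), y⟫_ℂ) : x = y := by
  apply mFourierBasis.repr.injective
  apply lp.ext
  funext n
  rw [HilbertBasis.repr_apply_apply, HilbertBasis.repr_apply_apply, coe_mFourierBasis]
  exact h n

/-- **Symmetric Fourier coefficients force a.e. invariance**: if `⟪e_{n ∘ τ}, η⟫ = ⟪eₙ, η⟫` for all `n`,
then `η(t ∘ τ) = η(t)` for a.e. `t`. [folklore] -/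
theorem ae_eq_comp_perm_of_inner_symm (η : Lp ℂ 2 (volume : Measure (UnitAddTorus D))) (τ : Equiv.Perm D)
    (hsymm : ∀ n : D → ℤ, ⟪(mFourierLp 2 (fun i => n (τ i)) : Lp ℂ 2 (volume : Measure (UnitAddTorus D))), η⟫_ℂ =
      ⟪(mFourierLp 2 n : Lp ℂ 2 (volume : Measure (UnitAddTorus D))), η⟫_ℂ) :
    ∀ᵐ t ∂(volume : Measure (UnitAddTorus D)),
      (η : UnitAddTorus D → ℂ) (fun i => t (τ i)) = (η : UnitAddTorus D → ℂ) t := by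
  set ηT : Lp ℂ 2 (volume : Measure (UnitAddTorus D)) :=
    Lp.compMeasurePreserving _ (measurePreserving_compPerm (D := D) τ) η with hηT
  have hcoe : (ηT : UnitAddTorus D → ℂ) =ᵐ[volume] fun t => (η : UnitAddTorus D → ℂ) (fun i => t (τ i)) := by
    refine (Lp.coeFn_compMeasurePreserving η (measurePreserving_compPerm (D := D) τ)).trans ?_
    exact Eventually.of_forall fun t => by simp only [Function.comp_apply, compPerm_apply]
  have heq : ηT = η := by
    refine Lp_eq_of_forall_inner_mFourierLp_eq fun n => ?_
    rw [HaarTorus.inner_mFourierLp_eq_mFourierCoeff, HaarTorus.inner_mFourierLp_eq_mFourierCoeff]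
    calc mFourierCoeff (ηT : UnitAddTorus D → ℂ) n
        = mFourierCoeff (fun t => (η : UnitAddTorus D → ℂ) (fun i => t (τ i))) n :=
          integral_congr_ae (hcoe.mono fun t ht => by simp only [ht])
      _ = mFourierCoeff (η : UnitAddTorus D → ℂ) (fun i => n (τ i)) := mFourierCoeff_comp_compPerm _ τ n
      _ = mFourierCoeff (η : UnitAddTorus D → ℂ) n := by
          rw [← HaarTorus.inner_mFourierLp_eq_mFourierCoeff, ← HaarTorus.inner_mFourierLp_eq_mFourierCoeff, hsymm]
  rw [heq] at hcoe
  filter_upwards [hcoe] with t ht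
  exact ht.symm

/-- Conversely, **a.e. invariance gives symmetric Fourier coefficients** (for any a.e.-invariant
square-integrable class). [folklore] -/
theorem inner_symm_of_ae_eq_comp_perm (f : Lp ℂ 2 (volume : Measure (UnitAddTorus D))) (τ : Equiv.Perm D)
    (hae : ∀ᵐ t ∂(volume : Measure (UnitAddTorus D)),
      (f : UnitAddTorus D → ℂ) (fun i => t (τ i)) = (f : UnitAddTorus D → ℂ) t) (n : D → ℤ) :
    ⟪(mFourierLp 2 (fun i => n (τ i)) : Lp ℂ 2 (volume : Measure (UnitAddTorus D))), f⟫_ℂ =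
      ⟪(mFourierLp 2 n : Lp ℂ 2 (volume : Measure (UnitAddTorus D))), f⟫_ℂ := by
  rw [HaarTorus.inner_mFourierLp_eq_mFourierCoeff, HaarTorus.inner_mFourierLp_eq_mFourierCoeff,
    ← mFourierCoeff_comp_compPerm _ τ n]
  exact integral_congr_ae (hae.mono fun t ht => by simp only [ht])

end Symmetry

/-! ### The clamp truncations of a Bose-symmetric class -/

section Clamp

/-- `‖x‖² = ∫ ‖x‖₊²` for an `L²` class (finite integral). [folklore] -/
theorem norm_Lp_two_sq_eq_toReal {α : Type*} [MeasurableSpace α] {μ : Measure α} (x : Lp ℂ 2 μ) :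
    ‖x‖ ^ 2 = (∫⁻ t, ((‖(x : α → ℂ) t‖₊ : ℝ≥0∞)) ^ 2 ∂μ).toReal ∧ ∫⁻ t, ((‖(x : α → ℂ) t‖₊ : ℝ≥0∞)) ^ 2 ∂μ ≠ ⊤ := by
  have h2 : eLpNorm (x : α → ℂ) 2 μ = (∫⁻ t, ((‖(x : α → ℂ) t‖₊ : ℝ≥0∞)) ^ 2 ∂μ) ^ (1 / (2 : ℝ)) := by
    rw [eLpNorm_eq_lintegral_rpow_enorm_toReal two_ne_zero ENNReal.ofNat_ne_top, ENNReal.toReal_ofNat]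
    simp only [enorm_rpow_two_eq_coe_nnnorm_sq]
  have hfin : ∫⁻ t, ((‖(x : α → ℂ) t‖₊ : ℝ≥0∞)) ^ 2 ∂μ ≠ ⊤ := by
    intro htop
    have h := Lp.eLpNorm_lt_top x
    rw [h2, htop, ENNReal.top_rpow_of_pos (by norm_num)] at h
    exact lt_irrefl _ h
  refine ⟨?_, hfin⟩
  rw [Lp.norm_def, h2, ← ENNReal.toReal_rpow, ← Real.rpow_natCast, ← Real.rpow_mul ENNReal.toReal_nonneg]
  norm_num

variable (η : L2T N) (k : ℕ)

/-- `‖clampC k (η t)‖ ≤ 2k` a.e. for the clamp truncation `fₖ = clampC k ∘ η`. [folklore] -/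
theorem ae_norm_clampLp_le :
    ∀ᵐ t ∂(volume : Measure (UnitAddTorus (Fin N × Fin 3))),
      ‖(((lipschitzWith_clampC (k : ℝ)).compLp (clampC_zero (Nat.cast_nonneg k)) η : L2T N) :
        UnitAddTorus (Fin N × Fin 3) → ℂ) t‖ ≤ 2 * k := by
  filter_upwards [(lipschitzWith_clampC (k : ℝ)).coeFn_compLp (clampC_zero (Nat.cast_nonneg k)) η] with t ht
  rw [ht, Function.comp_apply]
  exact norm_clampC_le (Nat.cast_nonneg k) _

/-- The clamp truncation of a Bose-symmetric class is Bose-symmetric. [folklore] -/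
theorem inner_symm_clampLp
    (hsymm : ∀ (σ : Equiv.Perm (Fin N)) (n : Fin N × Fin 3 → ℤ),
      ⟪(mFourierLp 2 (fun p : Fin N × Fin 3 => n (σ p.1, p.2)) : L2T N), η⟫_ℂ = ⟪(mFourierLp 2 n : L2T N), η⟫_ℂ)
    (σ : Equiv.Perm (Fin N)) (n : Fin N × Fin 3 → ℤ) :
    ⟪(mFourierLp 2 (fun p : Fin N × Fin 3 => n (σ p.1, p.2)) : L2T N),
        (lipschitzWith_clampC (k : ℝ)).compLp (clampC_zero (Nat.cast_nonneg k)) η⟫_ℂ =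
      ⟪(mFourierLp 2 n : L2T N), (lipschitzWith_clampC (k : ℝ)).compLp (clampC_zero (Nat.cast_nonneg k)) η⟫_ℂ := by
  set τ : Equiv.Perm (Fin N × Fin 3) := Equiv.prodCongr σ (Equiv.refl (Fin 3)) with hτ
  have hτn : ∀ m : Fin N × Fin 3 → ℤ, (fun i => m (τ i)) = fun p : Fin N × Fin 3 => m (σ p.1, p.2) :=
    fun m => comp_prodCongr_eq σ m
  -- a.e. invariance of `η` under `t ↦ t ∘ τ`, then of `clampC k ∘ η`
  have hη : ∀ᵐ t ∂(volume : Measure (UnitAddTorus (Fin N × Fin 3))),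
      (η : UnitAddTorus (Fin N × Fin 3) → ℂ) (fun i => t (τ i)) = (η : UnitAddTorus (Fin N × Fin 3) → ℂ) t :=
    ae_eq_comp_perm_of_inner_symm η τ fun m => by rw [hτn]; exact hsymm σ m
  set f : L2T N := (lipschitzWith_clampC (k : ℝ)).compLp (clampC_zero (Nat.cast_nonneg k)) η with hf
  have hfc := (lipschitzWith_clampC (k : ℝ)).coeFn_compLp (clampC_zero (Nat.cast_nonneg k)) η
  have hfcT : ∀ᵐ t ∂(volume : Measure (UnitAddTorus (Fin N × Fin 3))),
      (f : UnitAddTorus (Fin N × Fin 3) → ℂ) (fun i => t (τ i)) = clampC k ((η : UnitAddTorus (Fin N × Fin 3) → ℂ) (fun i => t (τ i))) := by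
    have h := (measurePreserving_compPerm (D := Fin N × Fin 3) τ).quasiMeasurePreserving.ae_eq_comp hfc
    filter_upwards [h] with t ht
    simpa only [Function.comp_apply, compPerm_apply] using ht
  have hfae : ∀ᵐ t ∂(volume : Measure (UnitAddTorus (Fin N × Fin 3))),
      (f : UnitAddTorus (Fin N × Fin 3) → ℂ) (fun i => t (τ i)) = (f : UnitAddTorus (Fin N × Fin 3) → ℂ) t := by
    filter_upwards [hη, hfc, hfcT] with t h1 h2 h3
    rw [h3, h1, h2, Function.comp_apply]
  rw [← hτn]
  exact inner_symm_of_ae_eq_comp_perm f τ hfae n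

/-- **The clamp truncation does not increase the spectral kinetic energy** (Lipschitz maps contract
the Fourier-side `H¹` seminorms, `Torus.tsum_weight_mul_enorm_mFourierCoeff_clampC_le`). [folklore] -/
theorem tsum_kinetic_clampLp_le :
    ∑' n : Fin N × Fin 3 → ℤ, ENNReal.ofReal (∑ p, (2 * Real.pi * (n p : ℝ) / L) ^ 2) *
        (‖⟪(mFourierLp 2 n : L2T N), (lipschitzWith_clampC (k : ℝ)).compLp (clampC_zero (Nat.cast_nonneg k)) η⟫_ℂ‖₊ :
          ℝ≥0∞) ^ 2 ≤
      ∑' n : Fin N × Fin 3 → ℤ, ENNReal.ofReal (∑ p, (2 * Real.pi * (n p : ℝ) / L) ^ 2) *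
        (‖⟪(mFourierLp 2 n : L2T N), η⟫_ℂ‖₊ : ℝ≥0∞) ^ 2 := by
  classical
  have hηmem : MemLp (η : UnitAddTorus (Fin N × Fin 3) → ℂ) 2
      (Measure.pi fun _ : Fin N × Fin 3 => (AddCircle.haarAddCircle : Measure UnitAddCircle)) := Lp.memLp η
  have h := Torus.tsum_weight_mul_enorm_mFourierCoeff_clampC_le (d := Fin N × Fin 3) (k := (k : ℝ))
    (Nat.cast_nonneg k) (memLp_piHaar_iff.1 hηmem) (c := fun _ => (2 * Real.pi / L) ^ 2) (fun _ => sq_nonneg _)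
  have hw : ∀ n : Fin N × Fin 3 → ℤ, ENNReal.ofReal (∑ p, (2 * Real.pi * (n p : ℝ) / L) ^ 2) =
      ENNReal.ofReal (∑ p, (2 * Real.pi / L) ^ 2 * (n p : ℝ) ^ 2) := fun n => by
    congr 1
    refine Finset.sum_congr rfl fun p _ => ?_
    ring
  have hcoef : ∀ (x : L2T N) (n : Fin N × Fin 3 → ℤ), ((‖⟪(mFourierLp 2 n : L2T N), x⟫_ℂ‖₊ : ℝ≥0∞)) ^ 2 =
      ‖mFourierCoeff (x : UnitAddTorus (Fin N × Fin 3) → ℂ) n‖ₑ ^ 2 := fun x n => by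
    rw [HaarTorus.inner_mFourierLp_eq_mFourierCoeff, enorm_eq_nnnorm]
  have hfk : ∀ n : Fin N × Fin 3 → ℤ,
      mFourierCoeff (((lipschitzWith_clampC (k : ℝ)).compLp (clampC_zero (Nat.cast_nonneg k)) η : L2T N) :
        UnitAddTorus (Fin N × Fin 3) → ℂ) n =
      mFourierCoeff (clampC k ∘ (η : UnitAddTorus (Fin N × Fin 3) → ℂ)) n := fun n =>
    integral_congr_ae (((lipschitzWith_clampC (k : ℝ)).coeFn_compLp (clampC_zero (Nat.cast_nonneg k)) η).mono
      fun t ht => by simp only [ht])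
  simp only [hw, hcoef, hfk]
  exact h

/-- The clamp truncation does not increase the potential energy. [folklore] -/
theorem lintegral_pot_clampLp_le (W : UnitAddTorus (Fin N × Fin 3) → ℝ≥0∞) :
    ∫⁻ t, W t * (‖(((lipschitzWith_clampC (k : ℝ)).compLp (clampC_zero (Nat.cast_nonneg k)) η : L2T N) :
        UnitAddTorus (Fin N × Fin 3) → ℂ) t‖₊ : ℝ≥0∞) ^ 2 ≤
      ∫⁻ t, W t * (‖(η : UnitAddTorus (Fin N × Fin 3) → ℂ) t‖₊ : ℝ≥0∞) ^ 2 := by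
  refine lintegral_mono_ae (((lipschitzWith_clampC (k : ℝ)).coeFn_compLp (clampC_zero (Nat.cast_nonneg k)) η).mono
    fun t ht => ?_)
  rw [ht, Function.comp_apply]
  gcongr
  exact norm_clampC_le_norm (Nat.cast_nonneg k) _

/-- `∫ ‖fₖ‖₊² → ∫ ‖η‖₊²` for the clamp truncations (dominated convergence). [folklore] -/
theorem tendsto_lintegral_clampLp_sq (η : L2T N) :
    Tendsto (fun k : ℕ => ∫⁻ t, ((‖(((lipschitzWith_clampC (k : ℝ)).compLp (clampC_zero (Nat.cast_nonneg k)) η : L2T N) :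
        UnitAddTorus (Fin N × Fin 3) → ℂ) t‖₊ : ℝ≥0∞)) ^ 2) atTop
      (𝓝 (∫⁻ t, ((‖(η : UnitAddTorus (Fin N × Fin 3) → ℂ) t‖₊ : ℝ≥0∞)) ^ 2)) := by
  have hcoe : ∀ᵐ t ∂(volume : Measure (UnitAddTorus (Fin N × Fin 3))), ∀ k : ℕ,
      (((lipschitzWith_clampC (k : ℝ)).compLp (clampC_zero (Nat.cast_nonneg k)) η : L2T N) :
        UnitAddTorus (Fin N × Fin 3) → ℂ) t = clampC k ((η : UnitAddTorus (Fin N × Fin 3) → ℂ) t) :=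
    ae_all_iff.2 fun k => ((lipschitzWith_clampC (k : ℝ)).coeFn_compLp (clampC_zero (Nat.cast_nonneg k)) η).mono
      fun t ht => by rw [ht, Function.comp_apply]
  refine tendsto_lintegral_of_dominated_convergence' (fun t => ((‖(η : UnitAddTorus (Fin N × Fin 3) → ℂ) t‖₊ : ℝ≥0∞)) ^ 2)
    (fun k => (Lp.aestronglyMeasurable _).aemeasurable.nnnorm.coe_nnreal_ennreal.pow_const 2) ?_
    (norm_Lp_two_sq_eq_toReal η).2 ?_
  · intro k
    filter_upwards [hcoe] with t ht
    rw [ht k]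
    gcongr
    exact norm_clampC_le_norm (Nat.cast_nonneg k) _
  · filter_upwards [hcoe] with t ht
    simp only [ht]
    exact ((ENNReal.continuous_pow 2).tendsto _).comp
      ((ENNReal.continuous_coe.tendsto _).comp (tendsto_clampC _).nnnorm)

end Clamp

/-! ### The maximal-form bound -/

/-- The periodic interaction of a measurable profile is measurable (copy of the lemma of
`DiluteBoseGasUpperBoundLocalization.lean`, kept private to avoid that import). [folklore] -/
private theorem measurable_periodicInteraction_mfb {v : ℝ → ℝ≥0∞} (hv : Measurable v) (L : ℝ) :
    Measurable (periodicInteraction (N := N) v L) := by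
  unfold periodicInteraction periodizedPotential
  refine Finset.measurable_sum _ fun i _ => Finset.measurable_sum _ fun j _ => ?_
  exact (Measurable.tsum fun n => hv.comp (measurable_id.sub_const _).norm).comp
    ((measurable_config_apply i).sub (measurable_config_apply j))

/-- **The maximal-form bound, general Bose-symmetric class (integrable interaction).** For `L > 0`, a
measurable profile `w` with `∫_{[0,L)^{3N}} W < ∞` and `η ∈ L²((ℝ/ℤ)^{3N})` Bose-symmetric in momentum
space, `E₀(w) · ‖η‖² ≤ ∑ₙ (2πn/L)² |⟪eₙ, η⟫|² + ∫ (W ∘ fromUnitTorusN L) |η|²`. [cite: ReedSimonIV1978, Thm. XIII.64] -/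
theorem periodicGroundStateEnergy_mul_le_maxForm (hL : 0 < L) {w : ℝ → ℝ≥0∞} (hw : Measurable w)
    (hWint : ∫⁻ X in cellN N L, periodicInteraction w L X ≠ ⊤) (η : L2T N)
    (hsymm : ∀ (σ : Equiv.Perm (Fin N)) (n : Fin N × Fin 3 → ℤ),
      ⟪(mFourierLp 2 (fun p : Fin N × Fin 3 => n (σ p.1, p.2)) : L2T N), η⟫_ℂ = ⟪(mFourierLp 2 n : L2T N), η⟫_ℂ) :
    periodicGroundStateEnergy w N L * ENNReal.ofReal (‖η‖ ^ 2) ≤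
      ∑' n : Fin N × Fin 3 → ℤ, ENNReal.ofReal (∑ p, (2 * Real.pi * (n p : ℝ) / L) ^ 2) *
          (‖⟪(mFourierLp 2 n : L2T N), η⟫_ℂ‖₊ : ℝ≥0∞) ^ 2 +
        ∫⁻ t, periodicInteraction w L (fromUnitTorusN L t) *
          (‖(η : UnitAddTorus (Fin N × Fin 3) → ℂ) t‖₊ : ℝ≥0∞) ^ 2 := by
  set f : ℕ → L2T N := fun k => (lipschitzWith_clampC (k : ℝ)).compLp (clampC_zero (Nat.cast_nonneg k)) η with hf
  -- the bounded case for each truncation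
  have hk : ∀ k : ℕ, periodicGroundStateEnergy w N L * ENNReal.ofReal (‖f k‖ ^ 2) ≤
      ∑' n : Fin N × Fin 3 → ℤ, ENNReal.ofReal (∑ p, (2 * Real.pi * (n p : ℝ) / L) ^ 2) *
          (‖⟪(mFourierLp 2 n : L2T N), η⟫_ℂ‖₊ : ℝ≥0∞) ^ 2 +
        ∫⁻ t, periodicInteraction w L (fromUnitTorusN L t) *
          (‖(η : UnitAddTorus (Fin N × Fin 3) → ℂ) t‖₊ : ℝ≥0∞) ^ 2 := fun k =>
    (periodicGroundStateEnergy_mul_le_maxForm_of_bound hL hw hWint (f k) (ae_norm_clampLp_le η k)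
      (inner_symm_clampLp η k hsymm)).trans
      (add_le_add (tsum_kinetic_clampLp_le η k) (lintegral_pot_clampLp_le η k _))
  -- `‖f k‖² → ‖η‖²` as `ℝ≥0∞`-integrals
  have hnorm : ∀ x : L2T N, ENNReal.ofReal (‖x‖ ^ 2) = ∫⁻ t, ((‖(x : UnitAddTorus (Fin N × Fin 3) → ℂ) t‖₊ : ℝ≥0∞)) ^ 2 :=
    fun x => by rw [(norm_Lp_two_sq_eq_toReal x).1, ENNReal.ofReal_toReal (norm_Lp_two_sq_eq_toReal x).2]
  simp only [hnorm] at hk ⊢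
  by_cases h0 : ∫⁻ t, ((‖(η : UnitAddTorus (Fin N × Fin 3) → ℂ) t‖₊ : ℝ≥0∞)) ^ 2 = 0
  · rw [h0, mul_zero]
    exact zero_le
  have hlim := ENNReal.Tendsto.const_mul (tendsto_lintegral_clampLp_sq η) (Or.inl h0)
    (a := periodicGroundStateEnergy w N L)
  exact le_of_tendsto' hlim hk

/-- **MaxFormBound for integrable interactions** (the hypothesis `hcore` of the truncation argument, at a
fixed profile): for `L > 0`, measurable `w` with `∫_{[0,L)^{3N}} W < ∞`, and every UNIT `η ∈ L²((ℝ/ℤ)^{3N})`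
Bose-symmetric in momentum space,
`periodicGroundStateEnergy w N L ≤ ∑ₙ (2πn/L)² |⟪eₙ, η⟫|² + ∫ (W ∘ fromUnitTorusN L) |η|²`.
[cite: ReedSimonIV1978, Thm. XIII.64] -/
theorem periodicGroundStateEnergy_le_maxForm (hL : 0 < L) {w : ℝ → ℝ≥0∞} (hw : Measurable w)
    (hWint : ∫⁻ X in cellN N L, periodicInteraction w L X ≠ ⊤) (η : L2T N) (hη : ‖η‖ = 1)
    (hsymm : ∀ (σ : Equiv.Perm (Fin N)) (n : Fin N × Fin 3 → ℤ),
      ⟪(mFourierLp 2 (fun p : Fin N × Fin 3 => n (σ p.1, p.2)) : L2T N), η⟫_ℂ = ⟪(mFourierLp 2 n : L2T N), η⟫_ℂ) :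
    periodicGroundStateEnergy w N L ≤
      ∑' n : Fin N × Fin 3 → ℤ, ENNReal.ofReal (∑ p, (2 * Real.pi * (n p : ℝ) / L) ^ 2) *
          (‖⟪(mFourierLp 2 n : L2T N), η⟫_ℂ‖₊ : ℝ≥0∞) ^ 2 +
        ∫⁻ t, periodicInteraction w L (fromUnitTorusN L t) *
          (‖(η : UnitAddTorus (Fin N × Fin 3) → ℂ) t‖₊ : ℝ≥0∞) ^ 2 := by
  have h := periodicGroundStateEnergy_mul_le_maxForm hL hw hWint η hsymm
  rwa [hη, one_pow, ENNReal.ofReal_one, mul_one] at h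

end Literature.MathematicalPhysics.QuantumManyBody.BoseGas

end
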